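import Mathlib
import Summits.Ventures.HodgeRepro2.T5HigherUnitsIndex
import Summits.Ventures.HodgeRepro2.T5RamifiedUnitFiltration

/-!
# `[U_E : U_F U_E^{2k}] = q^k` at a ramified place (`e = 2`, `f = 1`)

The ramified counterpart of `T5HigherUnitsIndex.index_sup_eq_of_card` (`[U_E : U_F U_E^n] =
(q+1)q^{n-1}` at an inert place): for DVRs `R → S` with `algebraMap π = u·ϖ²` (`π`, `ϖ` uniformisers,
`e = 2`) and residue fields of the same order `q` (`f = 1`),

  `[Sˣ : U_F ⊔ U_E^{2k}] = q^k`   (`k ≥ 1`),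

because `U_F ∩ U_E^{2k} = U_F^k` (`T5RamifiedUnitFiltration.unitsMap_mem_higherUnits_even_iff`),
so `[Sˣ : U_F U_E^{2k}]·[Rˣ : U_F^k] = [Sˣ : U_E^{2k}]`, i.e. `x·(q−1)q^{k−1} = (q−1)q^{2k−1}`;
and, when every residue class of `S` contains an element of `R` (`f = 1`),
`U_F U_E^{2k+1} = U_F U_E^{2k}` (`higherUnits_two_mul_sup_eq`), so the odd levels add nothing:
`[Sˣ : U_F ⊔ U_E^{2k+1}] = q^k`. Lemma N5.L4(iv-b)'s «a character of the finite group
`E_v^×/F_v^×U_E^{2k}` non-trivial on `U_E^{2k-1}` exists» and its parenthesis «no conjugate-orthogonal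
character of odd conductor» are, quantitatively, `q^k > q^{k-1}` and `q^k = q^k`.

* `comap_unitsMap_higherUnits_two_mul`: `U_F ∩ U_E^{2k} = U_F^k`;
* `index_sup_mul_index`: `[Sˣ : U_F ⊔ U_E^{2k}]·[Rˣ : U_F^k] = [Sˣ : U_E^{2k}]`;
* `index_sup_two_mul_eq_of_card`: `[Sˣ : U_F ⊔ U_E^{2k}] = q^k` (`k ≥ 1`);
* `index_sup_two_mul_add_one_eq_of_card`: `[Sˣ : U_F ⊔ U_E^{2k+1}] = q^k`.

Declaration per README §8(d): «uses an L-value-free non-vanishing device: NO».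
-/

namespace Summit.Ventures.HodgeRepro2.T5RamifiedUnitIndex

open T5PrincipalUnitFiltration T5PrincipalUnitComparison

variable {R S : Type*} [CommRing R] [CommRing S] [Algebra R S] [IsDomain R] [IsDomain S]
  [IsDiscreteValuationRing R] [IsDiscreteValuationRing S] {π : R} {ϖ : S} {u : Sˣ}
  (hπ : Irreducible π) (hϖ : Irreducible ϖ) (hu : algebraMap R S π = u * ϖ ^ 2)

include hπ hϖ hu

omit [IsDiscreteValuationRing S] in
/-- `U_F ∩ U_E^{2k} = U_F^k` as a `comap`. -/
theorem comap_unitsMap_higherUnits_two_mul (k : ℕ) :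
    (higherUnits ϖ (2 * k)).comap (unitsMap (R := R) (S := S)) = higherUnits π k := by
  ext x
  rw [Subgroup.mem_comap]
  exact T5RamifiedUnitFiltration.unitsMap_mem_higherUnits_even_iff hπ hϖ hu k x

omit [IsDiscreteValuationRing S] in
/-- `[Sˣ : U_F ⊔ U_E^{2k}] · [Rˣ : U_F^k] = [Sˣ : U_E^{2k}]`. -/
theorem index_sup_mul_index (k : ℕ) :
    ((unitsMap (R := R) (S := S)).range ⊔ higherUnits ϖ (2 * k)).index * (higherUnits π k).index =
      (higherUnits ϖ (2 * k)).index := by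
  have h := Subgroup.relIndex_mul_index
    (le_sup_right : higherUnits ϖ (2 * k) ≤ (unitsMap (R := R) (S := S)).range ⊔ higherUnits ϖ (2 * k))
  rw [Subgroup.relIndex_sup_right, ← Subgroup.index_comap, comap_unitsMap_higherUnits_two_mul hπ hϖ hu k]
    at h
  rw [mul_comm]
  exact h

variable {q : ℕ} (hq : 2 ≤ q) (hk : Nat.card (IsLocalRing.ResidueField R) = q)
  (hku : Nat.card (IsLocalRing.ResidueField R)ˣ = q - 1)
  (hK : Nat.card (IsLocalRing.ResidueField S) = q)
  (hKu : Nat.card (IsLocalRing.ResidueField S)ˣ = q - 1)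

include hq hk hku hK hKu

/-- THE COUNT at a ramified place with `f = 1`: `[Sˣ : U_F ⊔ U_E^{2k}] = q^k` for `k ≥ 1`. -/
theorem index_sup_two_mul_eq_of_card {k : ℕ} (hk1 : 1 ≤ k) :
    ((unitsMap (R := R) (S := S)).range ⊔ higherUnits ϖ (2 * k)).index = q ^ k := by
  have h := index_sup_mul_index hπ hϖ hu k
  rw [T5HigherUnitsIndex.index_higherUnits hπ hk1, T5HigherUnitsIndex.index_higherUnits hϖ (by omega),
    hk, hku, hK, hKu] at h
  have hpos : 0 < (q - 1) * q ^ (k - 1) := by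
    have : 0 < q - 1 := by omega
    positivity
  apply Nat.eq_of_mul_eq_mul_right hpos
  rw [h, show 2 * k - 1 = k + (k - 1) by omega, pow_add]
  ring

/-- The odd levels add nothing when `f = 1`: `[Sˣ : U_F ⊔ U_E^{2k+1}] = q^k` (`k ≥ 1`). -/
theorem index_sup_two_mul_add_one_eq_of_card (hres : ∀ s : S, ∃ a, ϖ ∣ s - algebraMap R S a)
    {k : ℕ} (hk1 : 1 ≤ k) :
    ((unitsMap (R := R) (S := S)).range ⊔ higherUnits ϖ (2 * k + 1)).index = q ^ k := by
  rw [sup_comm, ← T5RamifiedUnitFiltration.higherUnits_two_mul_sup_eq hπ hϖ hu hres k, sup_comm]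
  exact index_sup_two_mul_eq_of_card hπ hϖ hu hq hk hku hK hKu hk1

end Summit.Ventures.HodgeRepro2.T5RamifiedUnitIndex
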